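import Mathlib.Analysis.SpecialFunctions.Pow.Deriv
import Mathlib.Analysis.SpecialFunctions.Pow.Continuity
import Literature.NumberTheory.Transcendental.KZCalculusProofs

/-!
# `CompleteModGammaSector` (stmt-KontsevichZagierPeriods-14233), line `cusp-transport-to-the-beta-world`:
# stub `stub_elliottPotentialT` — fibre regularity of the potential P along t

Support file (`--supports stmt-KontsevichZagierPeriods-14233`) for the registered stub `stub_elliottPotentialT` of the line lead's
skeleton `Cruxes/CompleteModGammaSector/Lines/cusp-transport-to-the-beta-world.lean`. Notation (functions of
`z : Fin 3 → ℝ`, `t = z 0`, `u = z 1`, `s = z 2`; rational `0 < a < 1`, `1 - a < c`; real algebraic modulus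
`z₁ ∈ (0,1)`): family `F = t^{-a}(1-t)^{c+a-2}(1-st)^{-a} · u^{-a}(1-u)^{c+a-2}(1-(1-s)u)^{-a} · (1 - st - (1-s)u)`
(Elliott–Legendre combination in Euler form, AQVV 2000 Cor. 3.13 (5); `a = 1/2`, `c = 1` is Legendre's relation),
potentials `P = t^{1-a}(1-t)^{c+a-1}(1-st)^{-a} · u^{1-a}(1-u)^{c+a-2}(1-(1-s)u)^{-a}`,
`Q = -t^{1-a}(1-t)^{c+a-2}(1-st)^{-a} · u^{1-a}(1-u)^{c+a-1}(1-(1-s)u)^{-a}`, certificate `∂_sF = ∂_tP + ∂_uQ`.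

References: M. Kontsevich, D. Zagier, *Periods* (2001), §1.2; G. D. Anderson, S.-L. Qiu, M. K. Vamanamurthy,
M. Vuorinen, *Generalized elliptic integrals and modular equations*, Pacific J. Math. 192 (2000), Cor. 3.13 (5);
G. E. Andrews, R. Askey, R. Roy, *Special Functions* (1999), Thm 3.2.8.
-/

noncomputable section

-- `Summit.KontsevichZagierPeriods.KontsevichZagierPeriods.…` is the tree's mandated layout (single-conjunct summit).
set_option linter.dupNamespace false

namespace Summit.KontsevichZagierPeriods.KontsevichZagierPeriods.CompleteModGammaSectorCuspLine

open MeasureTheory Set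
open Literature.NumberTheory.Transcendental

/-- One-variable core of `stub_elliottPotentialT`: for real exponent data `0 < A < 1`, `1 - A < C`, a slope
`0 ≤ s < 1` and a constant factor `K`, the fibre `v ↦ v^{1-A}(1-v)^{C+A-1}(1-sv)^{-A} · K` is continuous on `[0,1]`,
vanishes at `v = 0` and `v = 1`, and has the displayed (product-rule) derivative at every `v ∈ (0,1)`. -/
theorem potentialT_fibre_aux (A C s K : ℝ) (hA0 : 0 < A) (hA1 : A < 1) (hC : 1 - A < C)
    (hs0 : 0 ≤ s) (hs1 : s < 1) :
    ContinuousOn (fun v : ℝ => v ^ (1 - A) * (1 - v) ^ (C + A - 1) * (1 - s * v) ^ (-A) * K) (Set.Icc (0:ℝ) 1) ∧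
    (0:ℝ) ^ (1 - A) * (1 - 0) ^ (C + A - 1) * (1 - s * 0) ^ (-A) * K = 0 ∧
    (1:ℝ) ^ (1 - A) * (1 - 1) ^ (C + A - 1) * (1 - s * 1) ^ (-A) * K = 0 ∧
    ∀ v ∈ Set.Ioo (0:ℝ) 1, HasDerivAt
      (fun w : ℝ => w ^ (1 - A) * (1 - w) ^ (C + A - 1) * (1 - s * w) ^ (-A) * K)
      (v ^ (-A) * (1 - v) ^ (C + A - 2) * (1 - s * v) ^ (-A - 1) *
        ((1 - A) * (1 - v) * (1 - s * v) - (C + A - 1) * v * (1 - s * v) + A * s * v * (1 - v)) * K) v := by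
  have h1A : (0:ℝ) < 1 - A := by linarith
  have hCA : (0:ℝ) < C + A - 1 := by linarith
  refine ⟨?_, ?_, ?_, ?_⟩
  · -- continuity on `[0,1]`: the first two exponents are positive, the third base stays `≥ 1 - s > 0`
    have hsv : ∀ v ∈ Set.Icc (0:ℝ) 1, 1 - s * v ≠ 0 := by
      intro v hv
      have : s * v ≤ s := by nlinarith [hv.1, hv.2]
      linarith
    refine (ContinuousOn.mul (ContinuousOn.mul ?_ ?_) ?_).mul continuousOn_const
    · exact (continuous_id.rpow_const fun _ => Or.inr h1A.le).continuousOn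
    · exact ((continuous_const.sub continuous_id).rpow_const fun _ => Or.inr hCA.le).continuousOn
    · exact (continuous_const.sub (continuous_const.mul continuous_id)).continuousOn.rpow_const
        fun x hx => Or.inl (hsv x hx)
  · rw [Real.zero_rpow h1A.ne']
    simp
  · rw [sub_self, Real.zero_rpow hCA.ne']
    simp
  · intro v hv
    have hv0 : (0:ℝ) < v := hv.1
    have hv1 : v < 1 := hv.2
    have hvne : v ≠ 0 := hv0.ne'
    have h1v : (0:ℝ) < 1 - v := by linarith
    have h1vne : 1 - v ≠ 0 := h1v.ne'
    have hsv : (0:ℝ) < 1 - s * v := by nlinarith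
    have hsvne : 1 - s * v ≠ 0 := hsv.ne'
    have d1 : HasDerivAt (fun w : ℝ => w ^ (1 - A)) ((1 - A) * v ^ (1 - A - 1)) v :=
      Real.hasDerivAt_rpow_const (Or.inl hvne)
    have d2 : HasDerivAt (fun w : ℝ => (1 - w) ^ (C + A - 1))
        (-1 * (C + A - 1) * (1 - v) ^ (C + A - 1 - 1)) v :=
      ((hasDerivAt_id' v).const_sub 1).rpow_const (Or.inl h1vne)
    have d3 : HasDerivAt (fun w : ℝ => (1 - s * w) ^ (-A))
        (-(s * 1) * (-A) * (1 - s * v) ^ (-A - 1)) v :=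
      (((hasDerivAt_id' v).const_mul s).const_sub 1).rpow_const (Or.inl hsvne)
    have d := ((d1.mul d2).mul d3).mul_const K
    refine d.congr_deriv ?_
    have e4 : v ^ (1 - A - 1) = v ^ (-A) := by rw [show (1:ℝ) - A - 1 = -A by ring]
    have e5 : (1 - v) ^ (C + A - 1 - 1) = (1 - v) ^ (C + A - 2) := by
      rw [show C + A - 1 - 1 = C + A - 2 by ring]
    have e1 : v ^ (1 - A) = v ^ (-A) * v := by
      rw [← Real.rpow_add_one hvne, show -A + 1 = 1 - A by ring]
    have e2 : (1 - v) ^ (C + A - 1) = (1 - v) ^ (C + A - 2) * (1 - v) := by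
      rw [← Real.rpow_add_one h1vne, show C + A - 2 + 1 = C + A - 1 by ring]
    have e3 : (1 - s * v) ^ (-A) = (1 - s * v) ^ (-A - 1) * (1 - s * v) := by
      rw [← Real.rpow_add_one hsvne, show -A - 1 + 1 = -A by ring]
    simp only [Pi.mul_apply]
    rw [e4, e5, e1, e2, e3]
    ring

/-- Stub `stub_elliottPotentialT` of line `cusp-transport-to-the-beta-world` (fibre regularity of the potential P along t). [cite: KontsevichZagier2001, §1.2] -/
theorem stub_elliottPotentialT : ∀ (a c : ℚ) (z₁ : ℝ), 0 < a → a < 1 → 1 - a < c → 0 < z₁ → z₁ < 1 → IsAlgebraic ℚ z₁ →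
    ∀ z : Fin 3 → ℝ, ((∀ j : Fin 2, z (Fin.castSucc j) ∈ Set.Ioo (0:ℝ) 1) ∧ z (Fin.last 2) ∈ Set.Ioo (0:ℝ) z₁) →
      ContinuousOn (fun v : ℝ => (fun z : Fin 3 → ℝ => (z 0) ^ (1 - (a : ℝ)) * (1 - z 0) ^ ((c : ℝ) + (a : ℝ) - 1) * (1 - z 2 * z 0) ^ (-(a : ℝ)) * ((z 1) ^ (1 - (a : ℝ)) * (1 - z 1) ^ ((c : ℝ) + (a : ℝ) - 2) * (1 - (1 - z 2) * z 1) ^ (-(a : ℝ)))) (Function.update z (Fin.castSucc (0 : Fin 2)) v)) (Set.Icc (0:ℝ) 1) ∧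
      (fun z : Fin 3 → ℝ => (z 0) ^ (1 - (a : ℝ)) * (1 - z 0) ^ ((c : ℝ) + (a : ℝ) - 1) * (1 - z 2 * z 0) ^ (-(a : ℝ)) * ((z 1) ^ (1 - (a : ℝ)) * (1 - z 1) ^ ((c : ℝ) + (a : ℝ) - 2) * (1 - (1 - z 2) * z 1) ^ (-(a : ℝ)))) (Function.update z (Fin.castSucc (0 : Fin 2)) 0) = 0 ∧
      (fun z : Fin 3 → ℝ => (z 0) ^ (1 - (a : ℝ)) * (1 - z 0) ^ ((c : ℝ) + (a : ℝ) - 1) * (1 - z 2 * z 0) ^ (-(a : ℝ)) * ((z 1) ^ (1 - (a : ℝ)) * (1 - z 1) ^ ((c : ℝ) + (a : ℝ) - 2) * (1 - (1 - z 2) * z 1) ^ (-(a : ℝ)))) (Function.update z (Fin.castSucc (0 : Fin 2)) 1) = 0 ∧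
      ∀ v ∈ Set.Ioo (0:ℝ) 1, HasDerivAt (fun w : ℝ => (fun z : Fin 3 → ℝ => (z 0) ^ (1 - (a : ℝ)) * (1 - z 0) ^ ((c : ℝ) + (a : ℝ) - 1) * (1 - z 2 * z 0) ^ (-(a : ℝ)) * ((z 1) ^ (1 - (a : ℝ)) * (1 - z 1) ^ ((c : ℝ) + (a : ℝ) - 2) * (1 - (1 - z 2) * z 1) ^ (-(a : ℝ)))) (Function.update z (Fin.castSucc (0 : Fin 2)) w))
        ((fun z : Fin 3 → ℝ => (z 0) ^ (-(a : ℝ)) * (1 - z 0) ^ ((c : ℝ) + (a : ℝ) - 2) * (1 - z 2 * z 0) ^ (-(a : ℝ) - 1) * ((1 - (a : ℝ)) * (1 - z 0) * (1 - z 2 * z 0) - ((c : ℝ) + (a : ℝ) - 1) * z 0 * (1 - z 2 * z 0) + (a : ℝ) * z 2 * z 0 * (1 - z 0)) * ((z 1) ^ (1 - (a : ℝ)) * (1 - z 1) ^ ((c : ℝ) + (a : ℝ) - 2) * (1 - (1 - z 2) * z 1) ^ (-(a : ℝ)))) (Function.update z (Fin.castSucc (0 : Fin 2)) v)) v := by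
  intro a c z₁ ha0 ha1 hc _ hz₁1 _ z hz
  have hA0 : (0:ℝ) < (a:ℝ) := by exact_mod_cast ha0
  have hA1 : (a:ℝ) < 1 := by exact_mod_cast ha1
  have hC : 1 - (a:ℝ) < (c:ℝ) := by exact_mod_cast hc
  have hs : z 2 ∈ Set.Ioo (0:ℝ) z₁ := hz.2
  have h0 : ∀ v : ℝ, Function.update z (Fin.castSucc (0 : Fin 2)) v 0 = v := fun v =>
    Function.update_self _ _ _
  have h1 : ∀ v : ℝ, Function.update z (Fin.castSucc (0 : Fin 2)) v 1 = z 1 := fun v =>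
    Function.update_of_ne (by decide) _ _
  have h2 : ∀ v : ℝ, Function.update z (Fin.castSucc (0 : Fin 2)) v 2 = z 2 := fun v =>
    Function.update_of_ne (by decide) _ _
  simp only [h0, h1, h2]
  exact potentialT_fibre_aux (a:ℝ) (c:ℝ) (z 2) _ hA0 hA1 hC hs.1.le (hs.2.trans hz₁1)

end Summit.KontsevichZagierPeriods.KontsevichZagierPeriods.CompleteModGammaSectorCuspLine
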